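import Mathlib
import Literature.Probability.MarkovChains.MetropolisHastings
import Literature.Probability.MarkovChains.TotalVariation

/-!
# LatticeQCDFlow / Scaling — tunnelling laws: move-locality prices topological freezing for EVERY exact sampler (v3.0, (C2c-T))

HONEST FRAMING: exact (Metropolis-corrected) sampling algorithms for lattice gauge theory; figures
of merit are autocorrelation/cost numbers at stated couplings and volumes; no continuum-physics
claim.

THEORY-2.md §3.3 / §5.12 (v3.0).  The printed diagnosis of topological freezing — "at lattice
spacings where the regions of field space 'between the topological sectors' are strongly suppressed,
it is unlikely that [an HMC] trajectory leads from one sector to another, because the fields along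
the trajectories are, to a good approximation, distributed according to their weight"
[Luscher2010WilsonFlow, §5 p.7]; "`τ_top ∼ exp F_b`, where `F_b` is the typical free-energy barrier
between different topological sectors" [DeldebbioMancaVicari2004, p.2] — is made a THEOREM about
Markov kernels, with the free-energy barrier replaced by an explicit SEPARATING SET.

ABSTRACT ENGINE (this file; the lattice separating sets are in `FluxTunnelling.lean`).
* SEPARATING SET `B` for a charge `Q` and a move relation `R` (hypothesis `hB`): every allowed move
  `R x y` that changes the charge starts or ends in `B`.
* **Pair law** `measure_chargeChange_le`: for any two random states `Y, Z` that are a.s. an allowed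
  move, `P{Q(Y) ≠ Q(Z)} ≤ P{Y ∈ B} + P{Z ∈ B}`.
* **Kernel law** `compProd_chargeChange_le` / `…_of_invariant`: for a Markov kernel `κ` whose moves
  are a.s. allowed and a `κ`-INVARIANT law `μ` (exactness!), the stationary one-step tunnelling
  probability is `(μ ⊗ κ){Q ≠ Q'} ≤ 2·μ(B)` — locality of the move × exactness of the sampler ⇒ the
  tunnelling rate is paid in equilibrium mass of the separating set, whatever the algorithm;
  with an EXCEPTIONAL SET (`measure_chargeChange_le_add`, `compProd_chargeChange_le_add_of_invariant`:
  `≤ 2·μ(B) + (μ ⊗ κ){¬R}`) for kernels whose moves are only mostly local (HMC with Gaussian momenta).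
* **`n`-step law** `measure_chargeChange_le_nsteps` (varying relations `R_k`, sets `B_k`):
  `P{Q(Z_n) ≠ Q(Z_0)} ≤ n·m` when every consecutive pair is an allowed move and
  `P{Z_k ∈ B_k} + P{Z_{k+1} ∈ B_k} ≤ m`; **sector persistence** `sectorReturn_ge`
  (`P{Q(Z_0) ∈ S, Q(Z_n) ∈ S} ≥ P{Q(Z_0) ∈ S} − n·m`) and the **indicator-autocovariance floor**
  `sectorAutocov_ge` (`Cov(1_S(Q Z_0), 1_S(Q Z_n)) ≥ a(1−a) − n·m`, i.e. the normalised sector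
  autocorrelation at lag `n` is `≥ 1 − n·m/(a(1−a))`: integrated autocorrelation time
  `τ_int ≳ a(1−a)/(4m)`).
* **Finite-state law** `tunnelRate_le` over the tree's `IsStationary π P` (no new definition)
  (`Literature.Probability.MarkovChains`): `Σ_{Q x ≠ Q y} π_x P_{xy} ≤ 2·π(B)` whenever every
  POSITIVE-probability charge-changing transition starts or ends in `B` — the same law for the
  finite chains of `Exactness/FlowMCMC.lean`, `Exactness/LocalUpdates.lean` (block / heat-bath /
  Metropolis kernels) with no measure theory.
These are the bottleneck (conductance) inequalities of Markov-chain theory specialised to a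
charge; what is new for the venture is only their use: the separating sets of `FluxTunnelling.lean`
turn them into finite-lattice, finite-`β` laws for small-step and patch-local samplers, pricing the
two evasions of `Barriers.TopologicalModeCollapse` that had no price (domain-decomposed / sub-volume
flow proposals; flow–HMC hybrids), and exhibiting GLOBAL proposals as the only unpriced class.
No sorry, no new axioms, no `def` (theorems only); constants verified by `lean check`.
-/

noncomputable section

open MeasureTheory ProbabilityTheory Set Filter Finset
open scoped ENNReal ProbabilityTheory

namespace Summit.Ventures.LatticeQCDFlow.Theory2.Tunnelling

variable {X ι : Type*}

/-! Throughout, a set `B` SEPARATES the charge `Q` along the move relation `R` when every allowed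
move that changes the charge starts or ends in `B`:
`∀ x y, R x y → Q x ≠ Q y → x ∈ B ∨ y ∈ B` (hypothesis `hB`; no definition is introduced). -/

/-! ## §1. The pair law and the kernel (stationary one-step) law -/

section Pair

variable {Ω : Type*} [MeasurableSpace Ω]

/-- **Pair law.**  If `(Y, Z)` is almost surely an allowed move, the probability that the charge
differs is at most `P{Y ∈ B} + P{Z ∈ B}`. [folklore] -/
theorem measure_chargeChange_le {R : X → X → Prop} {Q : X → ι} {B : Set X}
    (hB : ∀ ⦃x y⦄, R x y → Q x ≠ Q y → x ∈ B ∨ y ∈ B) (P : Measure Ω) {Y Z : Ω → X} (hR : ∀ᵐ ω ∂P, R (Y ω) (Z ω)) :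
    P {ω | Q (Y ω) ≠ Q (Z ω)} ≤ P (Y ⁻¹' B) + P (Z ⁻¹' B) := by
  calc P {ω | Q (Y ω) ≠ Q (Z ω)} ≤ P (Y ⁻¹' B ∪ Z ⁻¹' B) := by
        refine measure_mono_ae ?_
        filter_upwards [hR] with ω hω hne
        exact hB hω hne
    _ ≤ P (Y ⁻¹' B) + P (Z ⁻¹' B) := measure_union_le _ _

/-- Real-valued form of the pair law for finite measures. [folklore] -/
theorem measureReal_chargeChange_le {R : X → X → Prop} {Q : X → ι} {B : Set X}
    (hB : ∀ ⦃x y⦄, R x y → Q x ≠ Q y → x ∈ B ∨ y ∈ B) (P : Measure Ω) [IsFiniteMeasure P] {Y Z : Ω → X}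
    (hR : ∀ᵐ ω ∂P, R (Y ω) (Z ω)) :
    P.real {ω | Q (Y ω) ≠ Q (Z ω)} ≤ P.real (Y ⁻¹' B) + P.real (Z ⁻¹' B) := by
  rw [measureReal_def, measureReal_def, measureReal_def,
    ← ENNReal.toReal_add (measure_ne_top _ _) (measure_ne_top _ _)]
  exact ENNReal.toReal_mono (by finiteness) (measure_chargeChange_le hB P hR)

/-- **Pair law with an exceptional set.**  Without assuming the move is a.s. allowed:
`P{Q(Y) ≠ Q(Z)} ≤ P{Y ∈ B} + P{Z ∈ B} + P{¬R(Y,Z)}` (e.g. HMC steps with unbounded momenta: the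
last term is a Gaussian tail). [folklore] -/
theorem measure_chargeChange_le_add {R : X → X → Prop} {Q : X → ι} {B : Set X}
    (hB : ∀ ⦃x y⦄, R x y → Q x ≠ Q y → x ∈ B ∨ y ∈ B) (P : Measure Ω) (Y Z : Ω → X) :
    P {ω | Q (Y ω) ≠ Q (Z ω)} ≤ P (Y ⁻¹' B) + P (Z ⁻¹' B) + P {ω | ¬ R (Y ω) (Z ω)} := by
  calc P {ω | Q (Y ω) ≠ Q (Z ω)} ≤ P ((Y ⁻¹' B ∪ Z ⁻¹' B) ∪ {ω | ¬ R (Y ω) (Z ω)}) := by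
        refine measure_mono fun ω hne => ?_
        by_cases hω : R (Y ω) (Z ω)
        · exact Or.inl (hB hω hne)
        · exact Or.inr hω
    _ ≤ P (Y ⁻¹' B ∪ Z ⁻¹' B) + P {ω | ¬ R (Y ω) (Z ω)} := measure_union_le _ _
    _ ≤ P (Y ⁻¹' B) + P (Z ⁻¹' B) + P {ω | ¬ R (Y ω) (Z ω)} :=
        add_le_add (measure_union_le _ _) le_rfl

variable [MeasurableSpace X]

/-- **Kernel law (general form).**  For a Markov kernel `κ` whose moves from `μ`-typical points are
a.s. allowed, the `μ ⊗ κ`-mass of charge-changing pairs is at most `μ(B) + (κ ∘ μ)(B)`. [folklore] -/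
theorem compProd_chargeChange_le {R : X → X → Prop} {Q : X → ι} {B : Set X}
    (hB : ∀ ⦃x y⦄, R x y → Q x ≠ Q y → x ∈ B ∨ y ∈ B) (μ : Measure X) [SFinite μ] (κ : Kernel X X) [IsMarkovKernel κ]
    (hR : ∀ᵐ p ∂(μ ⊗ₘ κ), R p.1 p.2) :
    (μ ⊗ₘ κ) {p | Q p.1 ≠ Q p.2} ≤ μ B + (κ ∘ₘ μ) B := by
  have h := measure_chargeChange_le hB (μ ⊗ₘ κ) (Y := Prod.fst) (Z := Prod.snd) hR
  refine h.trans (add_le_add ?_ ?_)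
  · calc (μ ⊗ₘ κ) (Prod.fst ⁻¹' B) ≤ (μ ⊗ₘ κ).map Prod.fst B :=
          Measure.le_map_apply measurable_fst.aemeasurable B
      _ = μ B := by
          have hf : (μ ⊗ₘ κ).fst = μ := Measure.fst_compProd μ κ
          rw [Measure.fst] at hf
          rw [hf]
  · calc (μ ⊗ₘ κ) (Prod.snd ⁻¹' B) ≤ (μ ⊗ₘ κ).map Prod.snd B :=
          Measure.le_map_apply measurable_snd.aemeasurable B
      _ = (κ ∘ₘ μ) B := by
          have hs : (μ ⊗ₘ κ).snd = κ ∘ₘ μ := Measure.snd_compProd μ κ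
          rw [Measure.snd] at hs
          rw [hs]

/-- **Kernel law for EXACT samplers.**  If `μ` is `κ`-invariant (the sampler is exact for `μ`) and
the moves are a.s. allowed, the stationary one-step tunnelling probability is at most `2·μ(B)`.
[folklore] -/
theorem compProd_chargeChange_le_of_invariant {R : X → X → Prop} {Q : X → ι} {B : Set X}
    (hB : ∀ ⦃x y⦄, R x y → Q x ≠ Q y → x ∈ B ∨ y ∈ B) (μ : Measure X) [SFinite μ] (κ : Kernel X X) [IsMarkovKernel κ]
    (hinv : κ.Invariant μ) (hR : ∀ᵐ p ∂(μ ⊗ₘ κ), R p.1 p.2) :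
    (μ ⊗ₘ κ) {p | Q p.1 ≠ Q p.2} ≤ 2 * μ B := by
  have h := compProd_chargeChange_le hB μ κ hR
  have hi : (κ ∘ₘ μ) B = μ B := by rw [hinv.def]
  rw [hi, ← two_mul] at h
  exact h

/-- **Kernel law with an exceptional set**: `(μ ⊗ κ){Q ≠ Q'} ≤ 2·μ(B) + (μ ⊗ κ){¬R}` for a
`μ`-invariant Markov kernel, with no almost-sure hypothesis on the moves. [folklore] -/
theorem compProd_chargeChange_le_add_of_invariant {R : X → X → Prop} {Q : X → ι} {B : Set X}
    (hB : ∀ ⦃x y⦄, R x y → Q x ≠ Q y → x ∈ B ∨ y ∈ B) (μ : Measure X) [SFinite μ] (κ : Kernel X X)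
    [IsMarkovKernel κ] (hinv : κ.Invariant μ) :
    (μ ⊗ₘ κ) {p | Q p.1 ≠ Q p.2} ≤ 2 * μ B + (μ ⊗ₘ κ) {p | ¬ R p.1 p.2} := by
  have h := measure_chargeChange_le_add hB (μ ⊗ₘ κ) Prod.fst Prod.snd
  refine h.trans (add_le_add ?_ le_rfl)
  rw [two_mul]
  refine add_le_add ?_ ?_
  · calc (μ ⊗ₘ κ) (Prod.fst ⁻¹' B) ≤ (μ ⊗ₘ κ).map Prod.fst B :=
          Measure.le_map_apply measurable_fst.aemeasurable B
      _ = μ B := by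
          have hf : (μ ⊗ₘ κ).fst = μ := Measure.fst_compProd μ κ
          rw [Measure.fst] at hf
          rw [hf]
  · calc (μ ⊗ₘ κ) (Prod.snd ⁻¹' B) ≤ (μ ⊗ₘ κ).map Prod.snd B :=
          Measure.le_map_apply measurable_snd.aemeasurable B
      _ = μ B := by
          have hs : (μ ⊗ₘ κ).snd = κ ∘ₘ μ := Measure.snd_compProd μ κ
          rw [Measure.snd] at hs
          rw [hs, hinv.def]

/-- The a.s.-allowed-move hypothesis from a pointwise support condition: if from every `x` the
kernel moves only to `R x`-related points, then `μ ⊗ κ`-a.e. pair is allowed. [folklore] -/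
theorem ae_compProd_of_forall {R : X → X → Prop} (μ : Measure X) [SFinite μ] (κ : Kernel X X)
    [IsSFiniteKernel κ] (hRm : MeasurableSet {p : X × X | R p.1 p.2})
    (h : ∀ x, ∀ᵐ y ∂(κ x), R x y) : ∀ᵐ p ∂(μ ⊗ₘ κ), R p.1 p.2 := by
  rw [Measure.ae_compProd_iff hRm]
  exact Filter.Eventually.of_forall h

end Pair

/-! ## §2. The `n`-step law, sector persistence and the autocovariance floor -/

section Steps

variable {Ω : Type*} [MeasurableSpace Ω]

/-- **`n`-step tunnelling law.**  A process whose consecutive states are a.s. allowed moves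
(`R_k` at step `k`, separating sets `B_k`) and whose visits to the separating sets cost at most `m`
per step changes its charge over `n` steps with probability at most `n·m`. [folklore] -/
theorem measure_chargeChange_le_nsteps {R : ℕ → X → X → Prop} {Q : X → ι} {B : ℕ → Set X}
    (hB : ∀ k ⦃x y⦄, R k x y → Q x ≠ Q y → x ∈ B k ∨ y ∈ B k) (P : Measure Ω) (Z : ℕ → Ω → X)
    (hR : ∀ k, ∀ᵐ ω ∂P, R k (Z k ω) (Z (k + 1) ω)) {m : ℝ≥0∞}
    (hm : ∀ k, P (Z k ⁻¹' B k) + P (Z (k + 1) ⁻¹' B k) ≤ m) (n : ℕ) :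
    P {ω | Q (Z n ω) ≠ Q (Z 0 ω)} ≤ n * m := by
  induction n with
  | zero => simp
  | succ n ih =>
    calc P {ω | Q (Z (n + 1) ω) ≠ Q (Z 0 ω)}
        ≤ P ({ω | Q (Z n ω) ≠ Q (Z 0 ω)} ∪ {ω | Q (Z n ω) ≠ Q (Z (n + 1) ω)}) := by
          refine measure_mono fun ω hω => ?_
          by_cases h : Q (Z n ω) = Q (Z 0 ω)
          · right
            simp only [mem_setOf_eq] at hω ⊢
            rw [h]
            exact fun h' => hω h'.symm
          · exact Or.inl h
      _ ≤ P {ω | Q (Z n ω) ≠ Q (Z 0 ω)} + P {ω | Q (Z n ω) ≠ Q (Z (n + 1) ω)} :=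
          measure_union_le _ _
      _ ≤ n * m + m :=
          add_le_add ih ((measure_chargeChange_le (hB n) P (hR n)).trans (hm n))
      _ = ((n + 1 : ℕ) : ℝ≥0∞) * m := by push_cast; ring

/-- Real-valued `n`-step law for finite measures. [folklore] -/
theorem measureReal_chargeChange_le_nsteps {R : ℕ → X → X → Prop} {Q : X → ι} {B : ℕ → Set X}
    (hB : ∀ k ⦃x y⦄, R k x y → Q x ≠ Q y → x ∈ B k ∨ y ∈ B k) (P : Measure Ω) [IsFiniteMeasure P] (Z : ℕ → Ω → X)
    (hR : ∀ k, ∀ᵐ ω ∂P, R k (Z k ω) (Z (k + 1) ω)) {m : ℝ} (hm0 : 0 ≤ m)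
    (hm : ∀ k, P.real (Z k ⁻¹' B k) + P.real (Z (k + 1) ⁻¹' B k) ≤ m) (n : ℕ) :
    P.real {ω | Q (Z n ω) ≠ Q (Z 0 ω)} ≤ n * m := by
  have hm' : ∀ k, P (Z k ⁻¹' B k) + P (Z (k + 1) ⁻¹' B k) ≤ ENNReal.ofReal m := by
    intro k
    have hk := hm k
    rw [measureReal_def, measureReal_def] at hk
    calc P (Z k ⁻¹' B k) + P (Z (k + 1) ⁻¹' B k)
        = ENNReal.ofReal (P (Z k ⁻¹' B k)).toReal +
            ENNReal.ofReal (P (Z (k + 1) ⁻¹' B k)).toReal := by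
          rw [ENNReal.ofReal_toReal (measure_ne_top _ _), ENNReal.ofReal_toReal (measure_ne_top _ _)]
      _ = ENNReal.ofReal ((P (Z k ⁻¹' B k)).toReal + (P (Z (k + 1) ⁻¹' B k)).toReal) :=
          (ENNReal.ofReal_add ENNReal.toReal_nonneg ENNReal.toReal_nonneg).symm
      _ ≤ ENNReal.ofReal m := ENNReal.ofReal_le_ofReal hk
  have h := measure_chargeChange_le_nsteps hB P Z hR hm' n
  rw [measureReal_def]
  calc (P {ω | Q (Z n ω) ≠ Q (Z 0 ω)}).toReal ≤ ((n : ℝ≥0∞) * ENNReal.ofReal m).toReal :=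
        ENNReal.toReal_mono (ENNReal.mul_ne_top (by simp) ENNReal.ofReal_ne_top) h
    _ = n * m := by rw [ENNReal.toReal_mul, ENNReal.toReal_ofReal hm0]; simp

/-- **Sector persistence.**  The probability of being in the charge set `S` at times `0` AND `n` is
at least the probability at time `0` minus the `n`-step tunnelling budget. [folklore] -/
theorem sectorReturn_ge {R : ℕ → X → X → Prop} {Q : X → ι} {B : ℕ → Set X}
    (hB : ∀ k ⦃x y⦄, R k x y → Q x ≠ Q y → x ∈ B k ∨ y ∈ B k) (P : Measure Ω) [IsFiniteMeasure P] (Z : ℕ → Ω → X)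
    (hR : ∀ k, ∀ᵐ ω ∂P, R k (Z k ω) (Z (k + 1) ω)) {m : ℝ} (hm0 : 0 ≤ m)
    (hm : ∀ k, P.real (Z k ⁻¹' B k) + P.real (Z (k + 1) ⁻¹' B k) ≤ m) (S : Set ι) (n : ℕ) :
    P.real {ω | Q (Z 0 ω) ∈ S} - n * m ≤ P.real {ω | Q (Z 0 ω) ∈ S ∧ Q (Z n ω) ∈ S} := by
  have hsub : {ω | Q (Z 0 ω) ∈ S} ⊆
      {ω | Q (Z 0 ω) ∈ S ∧ Q (Z n ω) ∈ S} ∪ {ω | Q (Z n ω) ≠ Q (Z 0 ω)} := by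
    intro ω hω
    by_cases h : Q (Z n ω) = Q (Z 0 ω)
    · left; exact ⟨hω, by simp only [mem_setOf_eq] at hω ⊢; rw [h]; exact hω⟩
    · right; exact h
  have h1 := measureReal_mono hsub (measure_ne_top P _)
  have h2 := measureReal_union_le (μ := P) {ω | Q (Z 0 ω) ∈ S ∧ Q (Z n ω) ∈ S}
    {ω | Q (Z n ω) ≠ Q (Z 0 ω)}
  have h3 := measureReal_chargeChange_le_nsteps hB P Z hR hm0 hm n
  linarith

/-- **Indicator-autocovariance floor.**  If the sector probability is the same number `a` at times
`0` and `n` (stationarity), then `Cov(1_S(Q Z_0), 1_S(Q Z_n)) ≥ a(1 − a) − n·m`; i.e. the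
normalised sector autocorrelation at lag `n` is at least `1 − n·m/(a(1−a))`. [folklore] -/
theorem sectorAutocov_ge {R : ℕ → X → X → Prop} {Q : X → ι} {B : ℕ → Set X}
    (hB : ∀ k ⦃x y⦄, R k x y → Q x ≠ Q y → x ∈ B k ∨ y ∈ B k) (P : Measure Ω) [IsFiniteMeasure P] (Z : ℕ → Ω → X)
    (hR : ∀ k, ∀ᵐ ω ∂P, R k (Z k ω) (Z (k + 1) ω)) {m : ℝ} (hm0 : 0 ≤ m)
    (hm : ∀ k, P.real (Z k ⁻¹' B k) + P.real (Z (k + 1) ⁻¹' B k) ≤ m) (S : Set ι) (n : ℕ)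
    {a : ℝ} (h0 : P.real {ω | Q (Z 0 ω) ∈ S} = a) (hn : P.real {ω | Q (Z n ω) ∈ S} = a) :
    a * (1 - a) - n * m ≤
      P.real {ω | Q (Z 0 ω) ∈ S ∧ Q (Z n ω) ∈ S} -
        P.real {ω | Q (Z 0 ω) ∈ S} * P.real {ω | Q (Z n ω) ∈ S} := by
  have h := sectorReturn_ge hB P Z hR hm0 hm S n
  rw [h0] at h
  rw [h0, hn]
  nlinarith

end Steps

/-! ## §3. The finite-state law over `IsStationary` -/

section Finite

open Literature.Probability.MarkovChains

variable {X : Type*} [Fintype X] {ι : Type*} [DecidableEq ι]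

/-- **Finite-state tunnelling law.**  The stationary TUNNELLING RATE of a finite chain is the
`π ⊗ P`-mass of the charge-changing transitions, `Σ_{x,y : Q x ≠ Q y} π_x P_{xy}` (written out; no
definition is introduced).  If `π ≥ 0` is stationary for the stochastic matrix `P ≥ 0` and every
positive-probability charge-changing transition starts or ends in `B`, it is at most `2·π(B)`.
[folklore] -/
theorem tunnelRate_le [DecidableEq X] {π : X → ℝ} {P : X → X → ℝ} (hπ : ∀ x, 0 ≤ π x)
    (hP : ∀ x y, 0 ≤ P x y) (hrow : ∀ x, ∑ y, P x y = 1) (hst : IsStationary π P)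
    {Q : X → ι} {B : Finset X} (hB : ∀ x y, 0 < P x y → Q x ≠ Q y → x ∈ B ∨ y ∈ B) :
    (∑ x, ∑ y, if Q x = Q y then 0 else π x * P x y) ≤ 2 * ∑ x ∈ B, π x := by
  classical
  set ix : X → ℝ := fun x => if x ∈ B then 1 else 0 with hix
  have hix0 : ∀ x, 0 ≤ ix x := fun x => by simp only [hix]; split_ifs <;> norm_num
  -- termwise domination by the two indicator terms
  have hterm : ∀ x y, (if Q x = Q y then 0 else π x * P x y) ≤
      π x * P x y * ix x + π x * P x y * ix y := by
    intro x y
    have hxy : 0 ≤ π x * P x y := mul_nonneg (hπ x) (hP x y)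
    have h1 : 0 ≤ π x * P x y * ix x := mul_nonneg hxy (hix0 x)
    have h2 : 0 ≤ π x * P x y * ix y := mul_nonneg hxy (hix0 y)
    by_cases hQ : Q x = Q y
    · rw [if_pos hQ]; exact add_nonneg h1 h2
    rw [if_neg hQ]
    by_cases hx : x ∈ B
    · have : ix x = 1 := by simp only [hix, if_pos hx]
      rw [this, mul_one]; linarith
    by_cases hy : y ∈ B
    · have : ix y = 1 := by simp only [hix, if_pos hy]
      rw [this, mul_one]; linarith
    rcases (hP x y).eq_or_lt with h0 | hpos
    · rw [← h0]; simp only [mul_zero, zero_mul, add_zero, le_refl]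
    · exact absurd (hB x y hpos hQ) (by tauto)
  have e1 : ∑ x, ∑ y, π x * P x y * ix x = ∑ x, ix x * π x := by
    refine Finset.sum_congr rfl fun x _ => ?_
    rw [← Finset.sum_mul, ← Finset.mul_sum, hrow x]; ring
  have e2 : ∑ x, ∑ y, π x * P x y * ix y = ∑ y, ix y * π y := by
    rw [Finset.sum_comm]
    refine Finset.sum_congr rfl fun y _ => ?_
    rw [← Finset.sum_mul, hst y]; ring
  have e3 : ∑ x, ix x * π x = ∑ x ∈ B, π x := by
    simp only [hix, ite_mul, one_mul, zero_mul, Finset.sum_ite_mem, Finset.univ_inter]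
  calc (∑ x, ∑ y, if Q x = Q y then 0 else π x * P x y)
      ≤ ∑ x, ∑ y, (π x * P x y * ix x + π x * P x y * ix y) :=
        Finset.sum_le_sum fun x _ => Finset.sum_le_sum fun y _ => hterm x y
    _ = (∑ x, ∑ y, π x * P x y * ix x) + ∑ x, ∑ y, π x * P x y * ix y := by
        rw [← Finset.sum_add_distrib]
        exact Finset.sum_congr rfl fun x _ => Finset.sum_add_distrib
    _ = 2 * ∑ x ∈ B, π x := by rw [e1, e2, e3, two_mul]

/-- The same for a row-stochastic `P` in the tree's bundled sense. [folklore] -/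
theorem tunnelRate_le_of_isRowStochastic [DecidableEq X] {π : X → ℝ} {P : X → X → ℝ}
    (hπ : ∀ x, 0 ≤ π x) (hP : IsRowStochastic P) (hst : IsStationary π P)
    {Q : X → ι} {B : Finset X} (hB : ∀ x y, 0 < P x y → Q x ≠ Q y → x ∈ B ∨ y ∈ B) :
    (∑ x, ∑ y, if Q x = Q y then 0 else π x * P x y) ≤ 2 * ∑ x ∈ B, π x :=
  tunnelRate_le hπ hP.1 hP.2 hst hB

end Finite

end Summit.Ventures.LatticeQCDFlow.Theory2.Tunnelling

end
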